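import Summits.QuantumFields.YangMills.Theorems.VirialFluxGapAnchorDensity
import Summits.QuantumFields.YangMills.Theorems.VirialFluxGapUniformTaylor
import Mathlib.MeasureTheory.Integral.Bochner.ContinuousLinearMap
import HarnessLib

/-!
# The WINDOW DATUM of the two-anchor density: `∫_Φ J(z,a) dz = w_Φ·(1 + ℓ(a) + e(a))` with UNIVERSAL constants
# (layer (B3) of the DIRECT Laplace road to ⟨stmt-QuantumFields-24204⟩ `VirialFluxGap.SharpTwistedLaplace`)

Helper module (free-hands work of width seat ym-line-sfw-p2-w3 g57, cell ym-idea-1; `--supports 24204`).  Combines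
✓`exists_ball_contDiffAt_anchorDensity` ∕ ✓`exists_ball_anchorDensity_ge` (the density `J = anchorDensity` is `C²` and `≥ J(0)/2 > 0` near the base
point) with ✓`UniformTaylor.exists_uniform_taylor_two` ∕ ✓`exists_bound_fderiv` and integrates over the group window `Φ = closedBall 0 r₀`:
* `exists_anchor_pointwise_datum` — a radius `r₀ ∈ (0,1)` and constants `C, D ≥ 0`, `m > 0` with, for `‖z‖, ‖a‖ ≤ r₀`:
  `|J(z,a) − J(z,0) − DJ(z,0)(0,a)| ≤ C‖a‖²`, `‖DJ(z,0)‖ ≤ D`, `J(z,0) ≥ m`, and continuity of `J` on the window;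
* ★★ `exists_anchor_window_datum` — THE `hw` DATUM of ✓`QuantitativeLaplace.laplaceMethod_quantitative_orbit_tube` for the anchor factor:
  measurable `ℓ` (odd, in fact linear) and `e` with `|ℓ(a)| ≤ D'‖a‖`, `|e(a)| ≤ G'‖a‖²` on `‖a‖ ≤ r₀` and
  `∫_{closedBall 0 r₀} J(z,a) dz = (∫_{closedBall 0 r₀} J(z,0) dz)·(1 + ℓ(a) + e(a))`, the base mass being `> 0`.
All constants are UNIVERSAL (no `L`, no twist, no sign class): they are never computed, only shown to exist, which is all the final
`K ≤ A·L^p` bookkeeping of ✓`sharpTwistedLaplace_of_fixTubes` needs.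
Everything here is PROVED; no definitions, no named facts (namespace `Summit.QuantumFields.YangMills.Theorems.VirialFluxGap.AnchorSlice`).
HONEST FRAMING: calculus ∕ measure theory in dimension 6; ⟨24204⟩, ⟨24319⟩ and every rung stay OPEN; the Yang–Mills mass gap (Clay) is NOT
touched; no summit is proved by a line.

## References
* K. W. Breitung, *Asymptotic Approximations for Probability Integrals*, LNM 1592 (1994), Lemma 7 p. 12; Thm 41 p. 56. [Breitung1994]
* E. Hasenpflug, D. Rudolf, B. Sprungk, Ann. Appl. Probab. 34 (2024), §3.1 Assumption 3. [HasenpflugRudolfSprungk2024]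
-/

set_option autoImplicit false

noncomputable section

open scoped Quaternion RealInnerProductSpace
open NormedSpace MeasureTheory Set Filter Topology Metric
open Literature.MathematicalPhysics.QuantumLattice
open Literature.MathematicalPhysics.QuantumFieldTheory.Balaban1983to89
open Literature.MathematicalPhysics.QuantumFieldTheory.Balaban1983to89.T4HaarSU2ExpChart
open Summit.QuantumFields.YangMills.Theorems.FemtoTransferGap
open Summit.QuantumFields.YangMills.Theorems.VirialFluxGap.UniformTaylor

namespace Summit.QuantumFields.YangMills.Theorems.VirialFluxGap.AnchorSlice

section Anchors

variable {ωC ωN ωX : EuclideanSpace ℝ (Fin 3)} {C₀ N₀ : SU2}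

/-- **Pointwise window data of the anchor density**: a radius `r₀ ∈ (0, 1)` and universal constants `C, D ≥ 0`, `m > 0` such that on
`‖z‖ ≤ r₀`, `‖a‖ ≤ r₀`: second-order expansion in `a` with remainder `≤ C‖a‖²`, `‖DJ(z,0)‖ ≤ D`, `J(z,0) ≥ m`; and `J` is continuous at every
point of the window. [cite: Breitung1994, Lemma 7 p. 12] -/
theorem exists_anchor_pointwise_datum (hC : ‖ωC‖ = 1) (hN : ‖ωN‖ = 1) (hCN : ⟪ωC, ωN⟫ = 0) (hX : imQuat ωX = imQuat ωC * imQuat ωN)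
    (hC₀ : su2Quat C₀ = imQuat ωC) (hN₀ : su2Quat N₀ = imQuat ωN ∨ su2Quat N₀ = -imQuat ωN) :
    ∃ r₀ : ℝ, 0 < r₀ ∧ r₀ < 1 ∧ ∃ C D m : ℝ, 0 ≤ C ∧ 0 ≤ D ∧ 0 < m ∧
      (∀ z ∈ closedBall (0 : EuclideanSpace ℝ (Fin 3)) r₀, ∀ a ∈ closedBall (0 : EuclideanSpace ℝ (Fin 3)) r₀,
        |anchorDensity ωC ωN ωX C₀ N₀ (z, a) - anchorDensity ωC ωN ωX C₀ N₀ (z, 0) -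
          fderiv ℝ (anchorDensity ωC ωN ωX C₀ N₀) (z, 0) ((0 : EuclideanSpace ℝ (Fin 3)), a)| ≤ C * ‖a‖ ^ 2) ∧
      (∀ z ∈ closedBall (0 : EuclideanSpace ℝ (Fin 3)) r₀, ‖fderiv ℝ (anchorDensity ωC ωN ωX C₀ N₀) (z, 0)‖ ≤ D) ∧
      (∀ z ∈ closedBall (0 : EuclideanSpace ℝ (Fin 3)) r₀, m ≤ anchorDensity ωC ωN ωX C₀ N₀ (z, 0)) ∧
      (∀ w : EuclideanSpace ℝ (Fin 3) × EuclideanSpace ℝ (Fin 3), ‖w‖ ≤ r₀ → ContinuousAt (anchorDensity ωC ωN ωX C₀ N₀) w) ∧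
      ContinuousOn (fun z : EuclideanSpace ℝ (Fin 3) => fderiv ℝ (anchorDensity ωC ωN ωX C₀ N₀) (z, 0))
        (closedBall (0 : EuclideanSpace ℝ (Fin 3)) r₀) := by
  obtain ⟨δ, hδ, hδ1, hsmooth⟩ := exists_ball_contDiffAt_anchorDensity hC hN hCN hX hC₀ hN₀ (n := 2)
  obtain ⟨δ', hδ', hpos⟩ := exists_ball_anchorDensity_ge hC hN hCN hX hC₀ hN₀
  set r₀ := min (δ / 3) (δ' / 3) with hr₀
  have hr₀pos : 0 < r₀ := lt_min (by linarith) (by linarith)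
  have hr₀δ : r₀ < δ := lt_of_le_of_lt (min_le_left _ _) (by linarith)
  have hr₀δ' : r₀ < δ' := lt_of_le_of_lt (min_le_right _ _) (by linarith)
  have hr₀1 : r₀ < 1 := lt_of_lt_of_le hr₀δ hδ1
  set J := anchorDensity ωC ωN ωX C₀ N₀ with hJ
  -- `J` is `C²` on the open ball of radius `δ`
  have hU : IsOpen (ball (0 : EuclideanSpace ℝ (Fin 3) × EuclideanSpace ℝ (Fin 3)) δ) := isOpen_ball
  have hF : ContDiffOn ℝ 2 J (ball (0 : EuclideanSpace ℝ (Fin 3) × EuclideanSpace ℝ (Fin 3)) δ) := fun w hw =>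
    ((hsmooth w (mem_ball_zero_iff.1 hw)).2).contDiffWithinAt
  have hK : IsCompact (closedBall (0 : EuclideanSpace ℝ (Fin 3)) r₀) := isCompact_closedBall 0 r₀
  have hKU : closedBall (0 : EuclideanSpace ℝ (Fin 3)) r₀ ×ˢ closedBall (0 : EuclideanSpace ℝ (Fin 3)) r₀ ⊆
      ball (0 : EuclideanSpace ℝ (Fin 3) × EuclideanSpace ℝ (Fin 3)) δ := by
    rintro ⟨z, a⟩ ⟨hz, ha⟩
    rw [mem_ball_zero_iff, Prod.norm_def]
    exact max_lt (lt_of_le_of_lt (mem_closedBall_zero_iff.1 hz) hr₀δ) (lt_of_le_of_lt (mem_closedBall_zero_iff.1 ha) hr₀δ)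
  have hKU0 : ∀ z ∈ closedBall (0 : EuclideanSpace ℝ (Fin 3)) r₀, (z, (0 : EuclideanSpace ℝ (Fin 3))) ∈
      ball (0 : EuclideanSpace ℝ (Fin 3) × EuclideanSpace ℝ (Fin 3)) δ := fun z hz =>
    hKU ⟨hz, mem_closedBall_zero_iff.2 (by rw [norm_zero]; exact hr₀pos.le)⟩
  obtain ⟨C, hC0, hCb⟩ := exists_uniform_taylor_two hU hF hK hKU
  obtain ⟨D, hD0, hDb⟩ := exists_bound_fderiv hU hF hK hKU0
  refine ⟨r₀, hr₀pos, hr₀1, C, D, anchorDensity ωC ωN ωX C₀ N₀ 0 / 2, hC0, hD0,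
    by linarith [anchorDensity_zero_pos hC hN hCN hX hC₀ hN₀], hCb, hDb, fun z hz => hpos (z, 0) ?_, fun w hw => ?_, ?_⟩
  · rw [Prod.norm_def, norm_zero, max_eq_left (norm_nonneg _)]
    exact lt_of_le_of_lt (mem_closedBall_zero_iff.1 hz) hr₀δ'
  · exact continuousAt_anchorDensity hC hN hCN hX hC₀ hN₀ (lt_of_le_of_lt ((norm_snd_le w).trans hw) hr₀1)
  · refine continuousOn_of_forall_continuousAt fun z hz => ?_
    have h2 : ContDiffAt ℝ 2 J (z, 0) := (hsmooth (z, 0) (mem_ball_zero_iff.1 (hKU0 z hz))).2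
    have h1 : ContDiffAt ℝ 1 (fderiv ℝ J) (z, 0) := h2.fderiv_right le_rfl
    have hz' : ContinuousAt (fun z' : EuclideanSpace ℝ (Fin 3) => (z', (0 : EuclideanSpace ℝ (Fin 3)))) z :=
      (continuous_id.prodMk continuous_const).continuousAt
    exact ContinuousAt.comp (g := fderiv ℝ J) (f := fun z' : EuclideanSpace ℝ (Fin 3) => (z', (0 : EuclideanSpace ℝ (Fin 3))))
      (x := z) h1.continuousAt hz'

/-- ★★ **THE WINDOW DATUM OF THE ANCHOR DENSITY** (the `hw` hypothesis of ✓`laplaceMethod_quantitative_orbit_tube` for the anchor factor, with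
UNIVERSAL constants): there are `r₀ ∈ (0,1)`, `D', G' ≥ 0`, measurable `ℓ` (odd) and `e` with `|ℓ(a)| ≤ D'‖a‖`, `|e(a)| ≤ G'‖a‖²` for `‖a‖ ≤ r₀`,
a POSITIVE base mass `w_Φ = ∫_{closedBall 0 r₀} J(z,0) dz`, and `∫_{closedBall 0 r₀} J(z,a) dz = w_Φ·(1 + ℓ(a) + e(a))` for `‖a‖ ≤ r₀`.
[cite: Breitung1994, Thm 41 p. 56; Lemma 7 p. 12] [cite: HasenpflugRudolfSprungk2024, §3.1 Assumption 3] -/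
theorem exists_anchor_window_datum (hC : ‖ωC‖ = 1) (hN : ‖ωN‖ = 1) (hCN : ⟪ωC, ωN⟫ = 0) (hX : imQuat ωX = imQuat ωC * imQuat ωN)
    (hC₀ : su2Quat C₀ = imQuat ωC) (hN₀ : su2Quat N₀ = imQuat ωN ∨ su2Quat N₀ = -imQuat ωN) :
    ∃ r₀ : ℝ, 0 < r₀ ∧ r₀ < 1 ∧ ∃ D' G' : ℝ, 0 ≤ D' ∧ 0 ≤ G' ∧
      0 < ∫ z in closedBall (0 : EuclideanSpace ℝ (Fin 3)) r₀, anchorDensity ωC ωN ωX C₀ N₀ (z, 0) ∧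
      ∃ ll ee : EuclideanSpace ℝ (Fin 3) → ℝ, Measurable ll ∧ Measurable ee ∧ (∀ a, ll (-a) = -ll a) ∧
        (∀ a : EuclideanSpace ℝ (Fin 3), ‖a‖ ≤ r₀ → |ll a| ≤ D' * ‖a‖) ∧
        (∀ a : EuclideanSpace ℝ (Fin 3), ‖a‖ ≤ r₀ → |ee a| ≤ G' * ‖a‖ ^ 2) ∧
        ∀ a : EuclideanSpace ℝ (Fin 3), ‖a‖ ≤ r₀ →
          ∫ z in closedBall (0 : EuclideanSpace ℝ (Fin 3)) r₀, anchorDensity ωC ωN ωX C₀ N₀ (z, a) =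
            (∫ z in closedBall (0 : EuclideanSpace ℝ (Fin 3)) r₀, anchorDensity ωC ωN ωX C₀ N₀ (z, 0)) * (1 + ll a + ee a) := by
  obtain ⟨r₀, hr₀, hr₀1, C, D, m, hC0, hD0, hm, hTaylor, hDb, hmb, hcont, hcontL⟩ := exists_anchor_pointwise_datum hC hN hCN hX hC₀ hN₀
  set J := anchorDensity ωC ωN ωX C₀ N₀ with hJ
  set Φ := closedBall (0 : EuclideanSpace ℝ (Fin 3)) r₀ with hΦ
  have hΦc : IsCompact Φ := isCompact_closedBall 0 r₀
  have hΦfin : volume Φ < ⊤ := hΦc.measure_lt_top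
  set V : ℝ := volume.real Φ with hV
  have hVpos : 0 < V := by
    rw [hV, measureReal_def, ENNReal.toReal_pos_iff]
    exact ⟨Metric.measure_closedBall_pos volume 0 hr₀, hΦfin⟩
  -- continuity / integrability on `Φ`
  have hcontΦ : ∀ a : EuclideanSpace ℝ (Fin 3), ‖a‖ ≤ r₀ → ContinuousOn (fun z => J (z, a)) Φ := by
    intro a ha
    refine continuousOn_of_forall_continuousAt fun z hz => ?_
    have hw : ‖((z, a) : EuclideanSpace ℝ (Fin 3) × EuclideanSpace ℝ (Fin 3))‖ ≤ r₀ := by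
      rw [Prod.norm_def]; exact max_le (mem_closedBall_zero_iff.1 hz) ha
    have hz' : ContinuousAt (fun z' : EuclideanSpace ℝ (Fin 3) => (z', a)) z := (continuous_id.prodMk continuous_const).continuousAt
    exact ContinuousAt.comp (g := J) (f := fun z' : EuclideanSpace ℝ (Fin 3) => (z', a)) (x := z) (hcont (z, a) hw) hz'
  have hintJ : ∀ a : EuclideanSpace ℝ (Fin 3), ‖a‖ ≤ r₀ → IntegrableOn (fun z => J (z, a)) Φ :=
    fun a ha => (hcontΦ a ha).integrableOn_compact hΦc
  have hr₀0 : ‖(0 : EuclideanSpace ℝ (Fin 3))‖ ≤ r₀ := by rw [norm_zero]; exact hr₀.le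
  have hLint : IntegrableOn (fun z : EuclideanSpace ℝ (Fin 3) => fderiv ℝ J (z, 0)) Φ := hcontL.integrableOn_compact hΦc
  -- the base mass
  set w₀ : ℝ := ∫ z in Φ, J (z, 0) with hw₀
  have hw₀pos : 0 < w₀ := by
    have h1 : ∫ z in Φ, (m : ℝ) ≤ ∫ z in Φ, J (z, 0) :=
      setIntegral_mono_on (integrableOn_const hΦfin.ne) (hintJ 0 hr₀0) measurableSet_closedBall fun z hz => hmb z hz
    rw [setIntegral_const, smul_eq_mul] at h1
    exact lt_of_lt_of_le (mul_pos hVpos hm) h1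
  -- the linear term
  set L : EuclideanSpace ℝ (Fin 3) × EuclideanSpace ℝ (Fin 3) →L[ℝ] ℝ := ∫ z in Φ, fderiv ℝ J (z, 0) with hL
  have hLapply : ∀ v, L v = ∫ z in Φ, fderiv ℝ J (z, 0) v := fun v => ContinuousLinearMap.integral_apply hLint v
  have hLnorm : ‖L‖ ≤ D * V := by
    rw [hL]
    exact norm_setIntegral_le_of_norm_le_const hΦfin fun z hz => hDb z hz
  refine ⟨r₀, hr₀, hr₀1, D * V / w₀, C * V / w₀, by positivity, by positivity, hw₀pos,
    fun a => L ((0 : EuclideanSpace ℝ (Fin 3)), a) / w₀,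
    fun a => (∫ z in Φ, J (z, a)) / w₀ - 1 - L ((0 : EuclideanSpace ℝ (Fin 3)), a) / w₀, ?_, ?_, ?_, ?_, ?_, ?_⟩
  · -- measurability of `ll`
    exact ((L.continuous.comp (continuous_const.prodMk continuous_id)).div_const _).measurable
  · -- measurability of `ee`
    have hsm : StronglyMeasurable fun a : EuclideanSpace ℝ (Fin 3) => ∫ z, J (z, a) ∂(volume.restrict Φ) :=
      (measurable_anchorDensity (ωC := ωC) (ωN := ωN) (ωX := ωX) (C₀ := C₀) (N₀ := N₀)).stronglyMeasurable.integral_prod_left'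
        (μ := volume.restrict Φ)
    exact ((hsm.measurable.div_const _).sub measurable_const).sub
      (((L.continuous.comp (continuous_const.prodMk continuous_id)).div_const _).measurable)
  · -- oddness
    intro a
    show L ((0 : EuclideanSpace ℝ (Fin 3)), -a) / w₀ = -(L ((0 : EuclideanSpace ℝ (Fin 3)), a) / w₀)
    have : ((0 : EuclideanSpace ℝ (Fin 3)), -a) = -((0 : EuclideanSpace ℝ (Fin 3)), a) := by simp
    rw [this, map_neg, neg_div]
  · -- the Lipschitz bound of the linear term
    intro a ha
    show |L ((0 : EuclideanSpace ℝ (Fin 3)), a) / w₀| ≤ D * V / w₀ * ‖a‖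
    rw [abs_div, abs_of_pos hw₀pos, div_le_iff₀ hw₀pos]
    have h1 : |L ((0 : EuclideanSpace ℝ (Fin 3)), a)| ≤ ‖L‖ * ‖a‖ := by
      have h := L.le_opNorm ((0 : EuclideanSpace ℝ (Fin 3)), a)
      rw [Real.norm_eq_abs, norm_zero_prod] at h
      exact h
    calc |L ((0 : EuclideanSpace ℝ (Fin 3)), a)| ≤ ‖L‖ * ‖a‖ := h1
      _ ≤ D * V * ‖a‖ := mul_le_mul_of_nonneg_right hLnorm (norm_nonneg _)
      _ = D * V / w₀ * ‖a‖ * w₀ := by field_simp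
  · -- the quadratic bound of the remainder
    intro a ha
    have ha' : a ∈ closedBall (0 : EuclideanSpace ℝ (Fin 3)) r₀ := mem_closedBall_zero_iff.2 ha
    have hintL : IntegrableOn (fun z : EuclideanSpace ℝ (Fin 3) => fderiv ℝ J (z, 0) ((0 : EuclideanSpace ℝ (Fin 3)), a)) Φ :=
      (ContinuousLinearMap.apply ℝ ℝ ((0 : EuclideanSpace ℝ (Fin 3)), a)).integrable_comp hLint
    have h12 : Integrable (fun z : EuclideanSpace ℝ (Fin 3) => J (z, a) - J (z, 0)) (volume.restrict Φ) :=
      (hintJ a ha).sub (hintJ 0 hr₀0)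
    have hsplit : ∫ z in Φ, (J (z, a) - J (z, 0) - fderiv ℝ J (z, 0) ((0 : EuclideanSpace ℝ (Fin 3)), a)) =
        (∫ z in Φ, J (z, a)) - w₀ - L ((0 : EuclideanSpace ℝ (Fin 3)), a) := by
      rw [integral_sub h12 hintL, integral_sub (hintJ a ha) (hintJ 0 hr₀0), hLapply]
    have hrem : (∫ z in Φ, J (z, a)) / w₀ - 1 - L ((0 : EuclideanSpace ℝ (Fin 3)), a) / w₀ =
        (∫ z in Φ, (J (z, a) - J (z, 0) - fderiv ℝ J (z, 0) ((0 : EuclideanSpace ℝ (Fin 3)), a))) / w₀ := by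
      rw [hsplit]
      field_simp
    show |(∫ z in Φ, J (z, a)) / w₀ - 1 - L ((0 : EuclideanSpace ℝ (Fin 3)), a) / w₀| ≤ C * V / w₀ * ‖a‖ ^ 2
    rw [hrem, abs_div, abs_of_pos hw₀pos, div_le_iff₀ hw₀pos]
    have hb := norm_setIntegral_le_of_norm_le_const (μ := (volume : Measure (EuclideanSpace ℝ (Fin 3)))) hΦfin
      (f := fun z => J (z, a) - J (z, 0) - fderiv ℝ J (z, 0) ((0 : EuclideanSpace ℝ (Fin 3)), a)) (C := C * ‖a‖ ^ 2)
      fun z hz => by rw [Real.norm_eq_abs]; exact hTaylor z hz a ha'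
    rw [Real.norm_eq_abs] at hb
    calc |∫ z in Φ, (J (z, a) - J (z, 0) - fderiv ℝ J (z, 0) ((0 : EuclideanSpace ℝ (Fin 3)), a))| ≤ C * ‖a‖ ^ 2 * V := hb
      _ = C * V / w₀ * ‖a‖ ^ 2 * w₀ := by field_simp
  · -- the identity
    intro a ha
    show ∫ z in Φ, J (z, a) = w₀ * (1 + L ((0 : EuclideanSpace ℝ (Fin 3)), a) / w₀ +
      ((∫ z in Φ, J (z, a)) / w₀ - 1 - L ((0 : EuclideanSpace ℝ (Fin 3)), a) / w₀))
    field_simp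
    ring

end Anchors

end Summit.QuantumFields.YangMills.Theorems.VirialFluxGap.AnchorSlice

end
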